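import Mathlib
import Summits.Ventures.PercRepro2.CrossAPrimeA2Induction
import Summits.Ventures.PercRepro2.BHKAvoid

/-!
# The `a₂`-side route, III: the bound `G_S ≤ c·m_S` and the free edge `{a₂, v}`
(blind cell PercRepro2, p5 g34; S4 §2.4 (s) addendum 29)

Under an admissible constant `c` (`Adm`), every `v`-mass is at most `c` times its `Q`-mass:
`P(C(a₂) ∈ 𝓤, a₁ ↔ v, Q) ≤ c · P(C(a₂) ∈ 𝓤, Q)` for every family `𝓤` (**`prob_Q_vL_le_mul`**;
exploring the cluster `K` of `a₂`, `P(a₁ ↔ v | K) = P(a₁ ↔ v in G ∖ K) ≤ c` on the support).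
Along an edge `e = {a₂, v}` the open pin puts `v` into the cluster of `a₂`, so every `v`-mass of
`p[e ↦ 1]` vanishes on `Q` and the middle coefficient of the quadratic is
`y¹·(c·x⁰ − xv⁰) + x¹·(c·y⁰ − yv⁰) + 2·Z¹·Dv⁰ ≥ 0` (**`a2_v_edge_step`**): the edge `{a₂, v}` is
free in the `a₂`-side induction.  Hence the open step only has to be proved for `w ∉ {a₁, v}`
(**`A2StepGeneric`**, **`a2Step_of_generic`**, **`crossA'so_nonneg_of_a2StepGeneric`**).
Own work; standard axioms.
-/

namespace Summit.Ventures.PercRepro2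

open LeafRowPendantRootSO CrossAPrimeSupport CrossAPrimeA2Route CrossAPrimeA2Induction

namespace CrossAPrimeA2VEdge

section Bound

variable {V : Type*} {E : Type*} [Fintype E] [DecidableEq E] [Fintype V] [DecidableEq V]
  {R : Type*} [Field R] [LinearOrder R] [IsStrictOrderedRing R]
variable {ends : E → Sym2 V}

omit [Fintype V] [DecidableEq V] in
/-- Expectations compare pointwise on the support. -/
lemma expect_mono_supp {p : E → R} (hp : IsProbVec p) {f g : Config E → R}
    (hfg : ∀ ω ∈ supp p, f ω ≤ g ω) : expect p f ≤ expect p g := by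
  unfold expect
  refine Finset.sum_le_sum fun ω _ => ?_
  by_cases hω : ω ∈ supp p
  · exact mul_le_mul_of_nonneg_left (hfg ω hω) (weight_nonneg hp ω)
  · rw [weight_eq_zero_of_not_mem_supp p hω]
    simp

omit [Fintype E] [DecidableEq E] [Fintype V] [DecidableEq V] [LinearOrder R]
  [IsStrictOrderedRing R] in
/-- On the support the cluster of `a₂` contains its sure cluster. -/
lemma sure_cluster_subset {p : E → R} {ω : Config E} (hω : ω ∈ supp p) (a₂ : V) :
    cluster ends (sureConfig p) a₂ ⊆ cluster ends ω a₂ :=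
  cluster_mono (sureConfig_le_of_mem_supp p hω) a₂

omit [Fintype E] [DecidableEq E] [Fintype V] [DecidableEq V] [LinearOrder R]
  [IsStrictOrderedRing R] in
/-- `{a₁ ↔ v}` as a cluster event of `a₁`. -/
lemma connEvent_eq_clusterInEvent_v (a₁ v : V) :
    connEvent ends a₁ v = clusterInEvent ends a₁ {A : Set V | v ∈ A} := by
  ext ω
  simp [connEvent, clusterInEvent, cluster]

omit [DecidableEq V] in
/-- **`G_S ≤ c·m_S`**: under an admissible `c`, `P(C(a₂) ∈ 𝓤, a₁ ↔ v, Q) ≤ c·P(C(a₂) ∈ 𝓤, Q)`. -/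
theorem prob_Q_vL_le_mul {p : E → R} (hp : IsProbVec p) {c : R} {a₁ a₂ v : V}
    (hadm : Adm p c ends a₁ a₂ v) (𝓤 : Set (Set V)) :
    prob p (clusterInEvent ends a₂ 𝓤 ∩ connEvent ends a₁ v ∩ avoidAll ends a₂ {a₁}) ≤
      c * prob p (clusterInEvent ends a₂ 𝓤 ∩ avoidAll ends a₂ {a₁}) := by
  classical
  rw [connEvent_eq_clusterInEvent_v a₁ v,
    prob_clusterIn_inter_avoid_eq_expect p ends a₂ a₁ (Finset.mem_singleton_self a₁) 𝓤
      {A : Set V | v ∈ A},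
    prob_clusterInEvent_inter_eq_expect, ← expect_const_mul]
  refine expect_mono_supp hp fun ω hω => ?_
  by_cases hQ : ω ∈ avoidAll ends a₂ {a₁}
  · have hg : delClusterProb p ends a₁ {A : Set V | v ∈ A} (cluster ends ω a₂) ≤ c := by
      have h1 : a₁ ∉ cluster ends ω a₂ := by
        rw [mem_avoidAll] at hQ
        exact fun h => hQ a₁ (Finset.mem_singleton_self a₁) h
      have := hadm (cluster ends ω a₂) (sure_cluster_subset hω a₂) h1
      unfold delClusterProb
      refine le_trans (le_of_eq ?_) this
      rfl
    have hU : 0 ≤ 𝓤.indicator (1 : Set V → R) (cluster ends ω a₂) :=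
      Set.indicator_apply_nonneg fun _ => zero_le_one
    rw [Set.indicator_of_mem hQ]
    simp only [Pi.one_apply, mul_one]
    calc 𝓤.indicator 1 (cluster ends ω a₂) * delClusterProb p ends a₁ {A : Set V | v ∈ A} (cluster ends ω a₂)
        ≤ 𝓤.indicator 1 (cluster ends ω a₂) * c := mul_le_mul_of_nonneg_left hg hU
      _ = c * 𝓤.indicator 1 (cluster ends ω a₂) := mul_comm _ _
  · rw [Set.indicator_of_notMem hQ]
    simp

end Bound

section VEdge

variable {V : Type*} {E : Type*} [Fintype E] [DecidableEq E] [Fintype V] [DecidableEq V]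
  {R : Type*} [Field R] [LinearOrder R] [IsStrictOrderedRing R]
variable {ends : E → Sym2 V}

omit [Fintype V] [DecidableEq V] [LinearOrder R] [IsStrictOrderedRing R] in
/-- With `e = {a₂, v}` pinned open, `Q ∩ {a₁ ↔ v} = ∅`: every `v`-mass of `p[e ↦ 1]` vanishes. -/
lemma prob_Q_vL_update_one_eq_zero (p : E → R) {e : E} {a₂ v : V} (he : ends e = s(a₂, v))
    (a₁ : V) (X : Set (Config E)) :
    prob (Function.update p e 1) (avoidAll ends a₂ {a₁} ∩ (connEvent ends a₁ v ∩ X)) = 0 := by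
  rw [← prob_update_one_inter_openEdge]
  have h : avoidAll ends a₂ {a₁} ∩ (connEvent ends a₁ v ∩ X) ∩ openEdge e = ∅ := by
    ext ω
    simp only [Set.mem_inter_iff, Set.mem_empty_iff_false, iff_false, not_and, and_imp]
    intro hQ hv _ ho
    rw [mem_avoidAll] at hQ
    apply hQ a₁ (Finset.mem_singleton_self a₁)
    have h2v : Conn ends ω a₂ v := conn_of_openAdj ⟨e, ho, he⟩
    exact conn_trans h2v (conn_symm hv)
  rw [h, prob_empty]

omit [Fintype E] [DecidableEq E] [Fintype V] [DecidableEq V] [LinearOrder R]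
  [IsStrictOrderedRing R] in
/-- `{o ∈ C(a₂)}` as a cluster event. -/
lemma connEvent_eq_clusterInEvent' (a₂ o : V) :
    connEvent ends a₂ o = clusterInEvent ends a₂ {A : Set V | o ∈ A} := by
  ext ω
  simp [connEvent, clusterInEvent, cluster]

omit [DecidableEq V] in
/-- **The edge `{a₂, v}` is free**: along `e = {a₂, v}`, for an admissible `c`, the middle
coefficient of the quadratic is nonnegative. -/
theorem a2_v_edge_step {p : E → R} (hp : IsProbVec p) {e : E} {a₂ v : V} (he : ends e = s(a₂, v))
    {c : R} {a₁ : V} (hadm : Adm p c ends a₁ a₂ v) (h1 : p e ≠ 1) (o b : V) :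
    0 ≤ crossPatC (Function.update p e 0) (Function.update p e 1) c ends o a₁ a₂ v b +
      crossPatC (Function.update p e 1) (Function.update p e 0) c ends o a₁ a₂ v b := by
  have hp0 : IsProbVec (Function.update p e 0) := hp.update e le_rfl zero_le_one
  have hp1 : IsProbVec (Function.update p e 1) := hp.update e zero_le_one le_rfl
  have hadm0 : Adm (Function.update p e 0) c ends a₁ a₂ v :=
    adm_update_zero hadm ⟨a₂, mem_cluster_self ends _ a₂, v, he⟩ h1
  -- the `v`-masses of `p[e ↦ 1]` vanish
  have z1 := prob_Q_vL_update_one_eq_zero p he a₁ (connEvent ends a₂ o ∩ connEvent ends a₂ b)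
  have z2 := prob_Q_vL_update_one_eq_zero p he a₁ (connEvent ends a₂ o)
  have z3 := prob_Q_vL_update_one_eq_zero p he a₁ (connEvent ends a₂ b)
  -- the `v`-masses of `p[e ↦ 0]` are at most `c` times the `Q`-masses
  have bx : prob (Function.update p e 0) (avoidAll ends a₂ {a₁} ∩ (connEvent ends a₁ v ∩ connEvent ends a₂ o)) ≤
      c * prob (Function.update p e 0) (avoidAll ends a₂ {a₁} ∩ connEvent ends a₂ o) := by
    have h := prob_Q_vL_le_mul hp0 hadm0 {A : Set V | o ∈ A}
    rw [← connEvent_eq_clusterInEvent'] at h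
    have e1 : connEvent ends a₂ o ∩ connEvent ends a₁ v ∩ avoidAll ends a₂ {a₁} =
        avoidAll ends a₂ {a₁} ∩ (connEvent ends a₁ v ∩ connEvent ends a₂ o) := by
      ext ω; simp only [Set.mem_inter_iff]; tauto
    have e2 : connEvent ends a₂ o ∩ avoidAll ends a₂ {a₁} =
        avoidAll ends a₂ {a₁} ∩ connEvent ends a₂ o := Set.inter_comm _ _
    rw [e1, e2] at h
    exact h
  have by' : prob (Function.update p e 0) (avoidAll ends a₂ {a₁} ∩ (connEvent ends a₁ v ∩ connEvent ends a₂ b)) ≤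
      c * prob (Function.update p e 0) (avoidAll ends a₂ {a₁} ∩ connEvent ends a₂ b) := by
    have h := prob_Q_vL_le_mul hp0 hadm0 {A : Set V | b ∈ A}
    rw [← connEvent_eq_clusterInEvent'] at h
    have e1 : connEvent ends a₂ b ∩ connEvent ends a₁ v ∩ avoidAll ends a₂ {a₁} =
        avoidAll ends a₂ {a₁} ∩ (connEvent ends a₁ v ∩ connEvent ends a₂ b) := by
      ext ω; simp only [Set.mem_inter_iff]; tauto
    have e2 : connEvent ends a₂ b ∩ avoidAll ends a₂ {a₁} =
        avoidAll ends a₂ {a₁} ∩ connEvent ends a₂ b := Set.inter_comm _ _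
    rw [e1, e2] at h
    exact h
  unfold crossPatC
  rw [z1, z2, z3]
  have hZ1 := prob_nonneg hp1 (avoidAll ends a₂ {a₁})
  have hDv0 := prob_nonneg hp0 (avoidAll ends a₂ {a₁} ∩
    (connEvent ends a₁ v ∩ (connEvent ends a₂ o ∩ connEvent ends a₂ b)))
  have hx1 := prob_nonneg hp1 (avoidAll ends a₂ {a₁} ∩ connEvent ends a₂ o)
  have hy1 := prob_nonneg hp1 (avoidAll ends a₂ {a₁} ∩ connEvent ends a₂ b)
  have k1 := mul_nonneg hy1 (sub_nonneg.2 bx)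
  have k2 := mul_nonneg hx1 (sub_nonneg.2 by')
  have k3 := mul_nonneg hZ1 hDv0
  nlinarith [k1, k2, k3]

/-- **The open step, generic form**: only the edges `{a₂, w}` with `w ∉ {a₁, v}`. -/
def A2StepGeneric (ends : E → Sym2 V) (o a₁ v b : V) : Prop :=
  ∀ (p : E → R) (r w : V) (e : E) (c : R), IsProbVec p → ends e = s(r, w) → r ≠ w → w ≠ a₁ →
    w ≠ v → p e ≠ 0 → p e ≠ 1 → Adm p c ends a₁ r v →
    0 ≤ crossC (Function.update p e 0) c ends o a₁ r v b →
    0 ≤ crossC (Function.update p e 1) c ends o a₁ r v b →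
    0 ≤ crossPatC (Function.update p e 0) (Function.update p e 1) c ends o a₁ r v b +
      crossPatC (Function.update p e 1) (Function.update p e 0) c ends o a₁ r v b

/-- The edge `{a₂, v}` being free, the generic step gives the full one. -/
theorem a2Step_of_generic {o a₁ v b : V} (H : A2StepGeneric (R := R) ends o a₁ v b) :
    A2Step (R := R) ends o a₁ v b := by
  intro p r w e c hp he hrw hw1 h0 h1 hadm hs0 hs1
  by_cases hwv : w = v
  · subst hwv
    exact a2_v_edge_step hp he hadm h1 o b
  · exact H p r w e c hp he hrw hw1 hwv h0 h1 hadm hs0 hs1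

/-- **The sign of `crossA′so` from the generic `a₂`-step.** -/
theorem crossA'so_nonneg_of_a2StepGeneric {o a₁ v b : V}
    (H : A2StepGeneric (R := R) ends o a₁ v b) (p : E → R) (hp : IsProbVec p) (a₂ : V) :
    0 ≤ crossA'so p ends o a₁ a₂ v b :=
  crossA'so_nonneg_of_a2Step (a2Step_of_generic H) p hp a₂

end VEdge

end CrossAPrimeA2VEdge

end Summit.Ventures.PercRepro2
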